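import Summits.QuantumFields.YangMills.Theorems.ColdStartUniversalityUniformColdStartMixingFixedCutoffEntropy
import Summits.QuantumFields.YangMills.Theorems.ColdStartUniversalityUniformColdStartMixingRungOfMixing
import Summits.QuantumFields.YangMills.Theorems.ColdStartUniversalityUniformColdStartMixingRung
import Summits.QuantumFields.YangMills.Theorems.ColdStartUniversalityNeutralColdStartMixingAbsValleyStub2
import HarnessLib

/-!
# Route `ColdStartUniversality`, crux K_A1|Γ `NeutralColdStartMixing` (stmt-QuantumFields-27363), LINE 7
# «valley_averaging»: THE FIXED-CUT-OFF RUNG OF STUB 2 — at every step `K`, `ValleyCesaroMixing` (as typed, and both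
# re-typings) holds with a `K`-dependent time, for EVERY Gibbs-a.e.-bounded measurable test function

Helper file (seat `ym-line-csu-p1`, g14; `--supports stmt-QuantumFields-27363`).  Witness of weakness (BC5-type) for item
27404 and for its centre-blind re-typings (`…ValleyRetypingsWeaker`, `…AbsValleyStub2`): the quantifier-swapped statement
`∀ K ∃ T₀(K)` is a THEOREM of the tree's fixed-cut-off machinery — uniform exponential mixing of the SZZ dynamics at fixed
`K` (`exp_mixing_szz`, g10: Harris with `V ≡ 1` from `doeblin_szz` + `wilsonMeasureLangevinInvariant_su2`), the Gibbs
dictionary (`gibbsMeasure_eq_map_wilsonMeasure`), Cesàro bookkeeping (`abs_sub_inv_mul_integral_le_of_le`,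
`inv_mul_integral_comp_div`) and, for test functions bounded only Gibbs-a.e., truncation plus the absolute continuity of
the law of `U_s` for `s > 0` (`stub_langevinLawAbsCont`, `fieldMeasure_absolutelyContinuous_gibbsMeasure`).  So the
ENTIRE content of stub 2 — as typed or re-typed — is the cut-off UNIFORMITY of `T₀`.

* ★ `valleyCesaroMixing_fixedCutoff` — for every `F`, `γ > 0`, `δ > 0` and `K` there is `T₀ > 0` such that for EVERY
  measurable `h` with `|h| ≤ 1` Gibbs-a.e. (no valley-measurability needed at fixed `K`), every cold-start solution and every
  `T ≥ T₀`: `|∫ h dGibbs_K − T⁻¹ ∫₀ᵀ E[h(U(s/ε_K))] ds| ≤ δ`.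

THEOREMS ONLY; RECORD-rung R3 plumbing; no crux, rung or summit statement is proved here and the Yang–Mills mass gap is
NOT proved.
-/

set_option autoImplicit false

noncomputable section

namespace Summit.QuantumFields.YangMills.Theorems.ColdStartUniversality

open MeasureTheory Filter
open scoped NNReal
open Literature.MathematicalPhysics.QuantumFieldTheory
open Literature.MathematicalPhysics.QuantumLattice (fundamentalRep fundamentalLatticeRep continuous_fundamentalRep)
open Literature.MathematicalPhysics.QuantumFieldTheory.Balaban1983to89

/-- ★ **THE FIXED-CUT-OFF RUNG OF `ValleyCesaroMixing`.**  At every step `K` (time `T₀` depending on `K`): for every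
measurable test function `h` with `|h| ≤ 1` Gibbs-a.e., every cold-start solution of the step-`K` SZZ dynamics at
`β' = (γ ε_K)⁻¹/2` and every `T ≥ T₀`, the physical-time Cesàro mean of `E[h(U(s/ε_K))]` is within `δ` of `∫ h dGibbs_K`.
[cite: ShenZhuZhu2022, §3 Lemma 3.3] -/
theorem valleyCesaroMixing_fixedCutoff :
    ∀ (F : T3ContinuumYM3Torus.T3Family) (γ : ℝ), 0 < γ → ∀ (δ : ℝ), 0 < δ → ∀ (K : ℕ), ∃ T₀ : ℝ, 0 < T₀ ∧
      ∀ (h : GaugeField (F.P K) 0 (Matrix.specialUnitaryGroup (Fin 2) ℂ) → ℝ), Measurable h →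
        (∀ᵐ V ∂(T4GenFunBounds.gibbsMeasure (G := Matrix.specialUnitaryGroup (Fin 2) ℂ) (F.P K)
          ((F.scheme (ExpMeanLog.expMeanLogSU : LoopAverage (Matrix.specialUnitaryGroup (Fin 2) ℂ)) γ).β K)), |h V| ≤ 1) →
        ∀ (Ω : Type) (mΩ : MeasurableSpace Ω) (P : Measure Ω) (_ : IsProbabilityMeasure P)
          (W : ℝ≥0 → Ω → (Edge 3 ((F.P K).sitesPerDir 0) × NoiseIdx 2 → ℝ)) (hW : IsFlatBrownian W P)
          (U : ℝ≥0 → Ω → GaugeConfig 3 ((F.P K).sitesPerDir 0) (Matrix.specialUnitaryGroup (Fin 2) ℂ)),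
          (∀ ω, U 0 ω = fun _ => 1) →
          (latticeLangevinDynamics (⟨2, fundamentalRep (Fin 2), continuous_fundamentalRep _,
              Literature.MathematicalPhysics.QuantumLattice.fundamentalRep_injective _,
              Literature.MathematicalPhysics.QuantumLattice.fundamentalRep_mem_unitaryGroup⟩ :
              LatticeRep (Matrix.specialUnitaryGroup (Fin 2) ℂ)) ((γ * (F.P K).eps)⁻¹ / 2)).IsSolution
            (fundamentalRep (Fin 2)) hW.natFiltration P W U →
          ∀ T : ℝ, T₀ ≤ T →
            |(∫ V, h V ∂(T4GenFunBounds.gibbsMeasure (G := Matrix.specialUnitaryGroup (Fin 2) ℂ) (F.P K)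
                ((F.scheme (ExpMeanLog.expMeanLogSU : LoopAverage (Matrix.specialUnitaryGroup (Fin 2) ℂ)) γ).β K))) -
              T⁻¹ * ∫ s in (0 : ℝ)..T, ∫ ω, h (fun b : PBond (F.P K) 0 => U (s / (F.P K).eps).toNNReal ω (b.src, b.dir)) ∂P|
              ≤ δ := by
  intro F γ hγ δ hδ K
  classical
  -- notation
  set ε : ℝ := (F.P K).eps with hεdef
  have hε : 0 < ε := (F.P K).eps_pos
  set β' : ℝ := (γ * ε)⁻¹ / 2 with hβ'
  have hβK : 0 ≤ (F.scheme (ExpMeanLog.expMeanLogSU : LoopAverage (Matrix.specialUnitaryGroup (Fin 2) ℂ)) γ).β K :=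
    F.scheme_β_nonneg _ hγ.le K
  set μG := T4GenFunBounds.gibbsMeasure (G := Matrix.specialUnitaryGroup (Fin 2) ℂ) (F.P K)
    ((F.scheme (ExpMeanLog.expMeanLogSU : LoopAverage (Matrix.specialUnitaryGroup (Fin 2) ℂ)) γ).β K) with hμG
  haveI : IsProbabilityMeasure μG :=
    T4GenFunBounds.isProbabilityMeasure_gibbsMeasure (G := Matrix.specialUnitaryGroup (Fin 2) ℂ) (F.P K) hβK
  set μW : Measure (GaugeConfig 3 ((F.P K).sitesPerDir 0) (Matrix.specialUnitaryGroup (Fin 2) ℂ)) :=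
    wilsonMeasure (d := 3) (L := (F.P K).sitesPerDir 0) (fundamentalRep (Fin 2)) β' with hμW
  set dict : GaugeConfig 3 ((F.P K).sitesPerDir 0) (Matrix.specialUnitaryGroup (Fin 2) ℂ) →
      GaugeField (F.P K) 0 (Matrix.specialUnitaryGroup (Fin 2) ℂ) := fun V => fun b : PBond (F.P K) 0 => V (b.src, b.dir)
    with hdict
  have hΦ : Measurable dict := measurable_pi_lambda _ fun b => measurable_pi_apply _
  have hG : μG = μW.map dict := gibbsMeasure_eq_map_wilsonMeasure (F.P K) hβK
  -- uniform exponential mixing at fixed `K`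
  obtain ⟨C, c, hC, hc, hmix⟩ := exp_mixing_szz ((F.P K).sitesPerDir 0) β'
  -- lattice horizon `Tl` with `C e^{-c t} ≤ δ/2` beyond it
  set Tl : ℝ := max 1 (Real.log (C / (δ / 2)) / c) with hTl
  have hTl1 : 1 ≤ Tl := le_max_left _ _
  have hTl0 : 0 < Tl := lt_of_lt_of_le one_pos hTl1
  have hexp : ∀ t : ℝ, Tl ≤ t → C * Real.exp (-c * t) ≤ δ / 2 := by
    intro t ht
    have hlog : Real.log (C / (δ / 2)) ≤ c * t := by
      have h := le_trans (le_max_right _ _) ht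
      rw [div_le_iff₀ hc] at h
      linarith [mul_comm t c]
    have h1 : Real.exp (-c * t) ≤ Real.exp (-Real.log (C / (δ / 2))) := Real.exp_le_exp.2 (by linarith)
    rw [Real.exp_neg, Real.exp_log (div_pos hC (by positivity)), inv_div] at h1
    calc C * Real.exp (-c * t) ≤ C * (δ / 2 / C) := mul_le_mul_of_nonneg_left h1 hC.le
      _ = δ / 2 := mul_div_cancel₀ _ hC.ne'
  -- physical threshold
  refine ⟨ε * (Tl + 4 * Tl / δ), by positivity, fun h hm hbd Ω mΩ P hP W hW U hU0 hsol T hT => ?_⟩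
  -- truncation `h'` of `h` at level 1: measurable, bounded everywhere, `= h` Gibbs-a.e.
  set h' : GaugeField (F.P K) 0 (Matrix.specialUnitaryGroup (Fin 2) ℂ) → ℝ := fun V => max (-1) (min 1 (h V)) with hh'
  have hm' : Measurable h' := measurable_const.max (measurable_const.min hm)
  have hb' : ∀ V, |h' V| ≤ 1 := fun V => by
    rw [abs_le]
    exact ⟨le_max_left _ _, max_le (by norm_num) (min_le_left _ _)⟩
  have hae : h' =ᵐ[μG] h := by
    filter_upwards [hbd] with V hV
    rw [abs_le] at hV
    show max (-1) (min 1 (h V)) = h V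
    rw [min_eq_right hV.2, max_eq_right hV.1]
  -- the observable on configurations and its Cesàro integrand in LATTICE time
  set f : GaugeConfig 3 ((F.P K).sitesPerDir 0) (Matrix.specialUnitaryGroup (Fin 2) ℂ) → ℝ := fun V => h' (dict V) with hf
  have hfm : Measurable f := hm'.comp hΦ
  have hfb : ∀ V, |f V| ≤ 1 := fun V => hb' _
  obtain ⟨hGb, hGi⟩ := integrand_bound_and_intervalIntegrable hW hsol hfm hfb
  -- the Gibbs mean through the dictionary
  have he : ∫ V, h V ∂μG = ∫ y, f y ∂μW := by
    rw [← integral_congr_ae hae, hG, integral_map hΦ.aemeasurable hm'.aestronglyMeasurable]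
  have he1 : |∫ y, f y ∂μW| ≤ 1 := by
    rw [← he, integral_congr_ae hae.symm]
    have hfn : ∀ᵐ V ∂μG, ‖h' V‖ ≤ 1 := ae_of_all _ fun V => by rw [Real.norm_eq_abs]; exact hb' V
    have h := norm_integral_le_of_norm_le_const hfn
    rw [Real.norm_eq_abs, probReal_univ, mul_one] at h
    exact h
  -- pointwise mixing in lattice time
  have hpt : ∀ t : ℝ, Tl ≤ t → |(∫ y, f y ∂μW) - ∫ ω, f (U t.toNNReal ω) ∂P| ≤ δ / 2 := by
    intro t ht
    have h0 : 0 ≤ t := le_trans hTl0.le ht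
    have h := hmix (fun _ => 1) t.toNNReal f hfm hfb Ω P W hW U hU0 hsol
    rw [abs_sub_comm] at h
    refine h.trans ?_
    rw [Real.coe_toNNReal t h0]
    exact hexp t ht
  -- Cesàro in lattice time
  have hTε : Tl + 4 * Tl / δ ≤ T / ε := by rwa [le_div_iff₀ hε, mul_comm]
  have hTpos : 0 < T := lt_of_lt_of_le (by positivity) hT
  have hces := abs_sub_inv_mul_integral_le_of_le (g := fun t : ℝ => ∫ ω, f (U t.toNNReal ω) ∂P) hTl0 hδ le_rfl he1 hGb hGi
    hpt hTε
  -- back to physical time: `T⁻¹ ∫₀ᵀ g(s/ε) ds = (T/ε)⁻¹ ∫₀^{T/ε} g`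
  have hscale : T⁻¹ * ∫ s in (0 : ℝ)..T, (∫ ω, f (U (s / ε).toNNReal ω) ∂P) =
      (T / ε)⁻¹ * ∫ t in (0 : ℝ)..(T / ε), ∫ ω, f (U t.toNNReal ω) ∂P := by
    have h := inv_mul_integral_comp_div (fun t : ℝ => ∫ ω, f (U t.toNNReal ω) ∂P) hε.ne' (div_pos hTpos hε).ne'
    rw [show ε * (T / ε) = T by field_simp] at h
    exact h
  -- along the flow, `h'` and `h` have the same expectations at positive times (law ≪ Haar ≪ Gibbs)
  have hflow : ∀ s : ℝ, 0 < s →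
      ∫ ω, f (U (s / ε).toNNReal ω) ∂P = ∫ ω, h (fun b : PBond (F.P K) 0 => U (s / (F.P K).eps).toNNReal ω (b.src, b.dir)) ∂P := by
    intro s hs
    have hspos : 0 < (s / (F.P K).eps).toNNReal := Real.toNNReal_pos.2 (div_pos hs hε)
    have hac := stub_langevinLawAbsCont F γ hγ K Ω mΩ P hP W hW U hU0 hsol _ hspos
    have hac' : P.map (fun ω => fun b : PBond (F.P K) 0 => U (s / (F.P K).eps).toNNReal ω (b.src, b.dir)) ≪ μG :=
      hac.trans (fieldMeasure_absolutelyContinuous_gibbsMeasure (F.P K)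
        ((F.scheme (ExpMeanLog.expMeanLogSU : LoopAverage (Matrix.specialUnitaryGroup (Fin 2) ℂ)) γ).β K))
    have hUm : Measurable (U (s / (F.P K).eps).toNNReal) := (hsol.adapted _).mono (hW.natFiltration.le _) le_rfl
    have hΨ : Measurable fun ω => (fun b : PBond (F.P K) 0 => U (s / (F.P K).eps).toNNReal ω (b.src, b.dir) :
        GaugeField (F.P K) 0 (Matrix.specialUnitaryGroup (Fin 2) ℂ)) := hΦ.comp hUm
    exact integral_congr_ae (ae_eq_comp' hΨ.aemeasurable hae hac')
  have hint : ∫ s in (0 : ℝ)..T, (∫ ω, f (U (s / ε).toNNReal ω) ∂P) =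
      ∫ s in (0 : ℝ)..T, ∫ ω, h (fun b : PBond (F.P K) 0 => U (s / (F.P K).eps).toNNReal ω (b.src, b.dir)) ∂P := by
    refine intervalIntegral.integral_congr_ae (ae_of_all _ fun s hs => ?_)
    rw [Set.uIoc_of_le hTpos.le] at hs
    exact hflow s hs.1
  rw [he, ← hint, hscale]
  exact hces

end Summit.QuantumFields.YangMills.Theorems.ColdStartUniversality

end
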